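import Summits.BirchSwinnertonDyer.Rank1Residual.Additive.MinimalModelKernelH1OfDeeplyRamified
import Literature.NumberTheory.EllipticCurves.CoatesGreenberg1996.GoodModelKernelH1Trivial
import HarnessLib

/-!
# `H¹(G, E₁(K̄_v)) = 0` for the `K_v`-minimal model from the good-model record AT `G`
# (the (I2)-derivation of Coates–Greenberg Cor. 3.2, pointwise in the closed subgroup `G`)

Cell `pub/bsd-print-x9`, road CG-FRAME (pen g14 «GO w3: CG-FRAME» 2026-08-29T00:29:56Z), brick
(C-asm-transport) of the x9-p1 LEAD: the frame-restricted kernel discharge of the leaf hCG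
(Greenberg LNM 1716 Prop. 2.4 = Coates–Greenberg Prop. 4.3, `Im κ = Im λ` at `v ∣ p` good ordinary
along a ramified `ℤ_p`-tower) for the anticyclotomic tower of an imaginary quadratic field at a split
prime, item stmt-BirchSwinnertonDyer-23237 `MuInequalityCoherentPairOfPrint`.  THEOREMS ONLY.

The tree derives Greenberg's input (I2) `WeierstrassCurve.CoatesGreenberg1996_H1_formalGroup_trivial`
(`H¹((ker κ)_v, E₁(K̄_v)) = 0` in cocycle form for the `K_v`-MINIMAL model, `κ` cyclotomic) from the
good-model record `CoatesGreenberg1996.H1_goodModelKernel_trivial` by ONE instance: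
`C` := the `K_v`-rational change to the minimal `𝓞_v`-model, `W₀ := localSpectralModel v`,
`G := (ker κ)_v` (`CoatesGreenberg1996_H1_formalGroup_trivial_of_goodModelKernel`, file
`CoatesGreenberg1996/GoodModelKernelH1Trivial` §2).  That derivation is a statement about the
∀-RECORD (all `K`, `κ` cyclotomic, `G ≤ (ker κ)_v`).  The CG-FRAME road produces the record's
CONCLUSION at ONE closed subgroup `G = (ker κ⁻)_v` of `Γ_{K_v}` which is NOT below a cyclotomic
kernel (x10b-p1-w2's subquotient form of Cor. 3.2: restriction to `N = (ker κ⁻)_v ⊓ (ker κ^{cyc})_v`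
+ the relative trace form above `N`, `AnticyclotomicLocalInertiaProofs`).  This file is the same
plumbing POINTWISE IN `G`:

* `WeierstrassCurve.exists_mem_localKernelOfReduction_eq_smul_sub_of_forall_goodModel` — for
  `E = W/K` elliptic over a number field, `v` a place of GOOD reduction, `G ≤ Γ_{K_v}` ANY subgroup:
  IF the record's conclusion holds at `G` for every spectral valuation `w`, every good model
  `W₀ = C • E ⊗ K̄_v` over `𝒪_w` fixed by `G` (hypothesis `hG`, the inner block of
  `H1_goodModelKernel_trivial` with its binders `w hw C W₀ hW₀ hΔ hGC` universally quantified and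
  `G` free), THEN every continuous crossed homomorphism `φ : G → E(K̄_v)` with values in
  `E₁(K̄_v) = W.localKernelOfReduction v` is `g ↦ g • a − a` with `a ∈ E₁(K̄_v)`.

Proof = the (I2)-derivation verbatim (instance `w := v.spectralValuation`, `C` := the minimal change
mapped to `K̄_v` — fixed by all of `Γ_{K_v}` —, `W₀ := localSpectralModel v`, unit discriminant by
good reduction; `localKernelOfReduction v` is by definition the pull-back of
`kernelOfReduction (localSpectralModel v)` along the same transport).  Consumer: the frame assembly
(C-asm) `… → ∀ φ, (∀ g, φ.1 g ∈ E₁) → ∃ a ∈ E₁, ∀ g, φ.1 g = g • a − a` at `G = (ker κ⁻)_v`, the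
pinned socket of x10b-p1-w7's (D) `strictKer_kernelOfReductionLocalDatum_le_localKerOver_of_forall_cocycle`.
HONEST FRAMING: plumbing only; nothing of Coates–Greenberg is discharged here; no item is closed by
this file; BSD is not proved by any of this; no summit statement is proved by this seat.

References: [CoatesGreenberg1996] J. Coates, R. Greenberg, Invent. Math. 124 (1996) §3 Cor. 3.2,
§4 Prop. 4.3; [GreenbergLNM1716] R. Greenberg, LNM 1716 (1999) §2 pp. 83–84, Prop. 2.4;
[SilvermanAEC2009] VII.1–2 (minimal models, the kernel of reduction).
-/

set_option autoImplicit false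
-- the Theorems namespace of this sub repeats the summit name by design (D-0017 nested layout)
set_option linter.dupNamespace false

noncomputable section

open scoped Classical NNReal
open NumberField IsDedekindDomain Field WeierstrassCurve Literature.NumberTheory.GaloisRepresentations
  Literature.NumberTheory.EllipticCurves Literature.NumberTheory.EllipticCurves.CoatesGreenberg1996
  IsDedekindDomain.HeightOneSpectrum

universe u

namespace WeierstrassCurve

variable {K : Type u} [Field K] [NumberField K]

/-- **`H¹(G, E₁(K̄_v)) = 0` for the minimal model from the good-model record AT `G`.**  For `E = W/K`
elliptic over a number field, `v` a place of good reduction and ANY subgroup `G ≤ Γ_{K_v}`: if for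
every spectral valuation `w` of `K̄_v`, every good model `W₀ = C • E ⊗ K̄_v` over `𝒪_w` with `C`
fixed by `G` (`hGC`), every continuous crossed homomorphism `G → E(K̄_v)` whose transported values
`Φ_C(φ g)` lie in `Ŵ₀(𝔪̄) = kernelOfReduction W₀ 𝒪_w` is `g ↦ g • a − a` with `Φ_C(a) ∈ Ŵ₀(𝔪̄)`
(hypothesis `hG` — the inner block of `CoatesGreenberg1996.H1_goodModelKernel_trivial` at this `G`),
then every continuous crossed homomorphism `φ : G → E(K̄_v)` with values in
`E₁(K̄_v) = W.localKernelOfReduction v` (the kernel of reduction of the `K_v`-minimal model) is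
`g ↦ g • a − a` with `a ∈ E₁(K̄_v)`.  The (I2)-derivation
`CoatesGreenberg1996_H1_formalGroup_trivial_of_goodModelKernel` pointwise in `G`: instance
`w := v.spectralValuation`, `C` := the `K_v`-rational change to the minimal `𝓞_v`-model (fixed by
every `σ ∈ Γ_{K_v}`), `W₀ := localSpectralModel v` (unit discriminant by good reduction).
[cite: GreenbergLNM1716, §2 p. 83 ("special case of Corollary 3.2 in [CoGr]")]
[cite: CoatesGreenberg1996, §3 Cor. 3.2] -/
theorem exists_mem_localKernelOfReduction_eq_smul_sub_of_forall_goodModel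
    (W : WeierstrassCurve K) [W.IsElliptic] (v : HeightOneSpectrum (𝓞 K))
    (hgood : W.HasGoodReductionAt v) (G : Subgroup (absoluteGaloisGroup (v.adicCompletion K)))
    (hG : ∀ (w : Valuation (AlgebraicClosure (v.adicCompletion K)) ℝ≥0)
      (_hw : ∀ x, (w x : ℝ) =
        spectralNorm (v.adicCompletion K) (AlgebraicClosure (v.adicCompletion K)) x)
      (C : VariableChange (AlgebraicClosure (v.adicCompletion K)))
      (W₀ : WeierstrassCurve w.integer)
      (hW₀ : C • (W.baseChange (v.adicCompletion K)).baseChange (AlgebraicClosure (v.adicCompletion K)) =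
        W₀.baseChange (AlgebraicClosure (v.adicCompletion K)))
      (_hΔ : IsUnit W₀.Δ)
      (_hGC : ∀ σ ∈ G,
        C.map ((absoluteGaloisGroup.toAlgEquiv (v.adicCompletion K) σ :
            AlgebraicClosure (v.adicCompletion K) ≃ₐ[v.adicCompletion K]
              AlgebraicClosure (v.adicCompletion K)) :
            AlgebraicClosure (v.adicCompletion K) →+* AlgebraicClosure (v.adicCompletion K)) = C),
      ∀ φ : contOneCocycles (discreteTopRep G (localPoints W (v.adicCompletion K))),
        (∀ g, Affine.Point.congrEquiv hW₀ (VariableChange.pointEquiv _ C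
            (Affine.Point.congrEquiv (baseChange_baseChange_adicCompletion W v).symm (φ.1 g))) ∈
          kernelOfReduction W₀ (Valuation.integer.integers w)) →
        ∃ a : localPoints W (v.adicCompletion K),
          Affine.Point.congrEquiv hW₀ (VariableChange.pointEquiv _ C
              (Affine.Point.congrEquiv (baseChange_baseChange_adicCompletion W v).symm a)) ∈
            kernelOfReduction W₀ (Valuation.integer.integers w) ∧
          ∀ g : G, φ.1 g = g • a - a)
    (φ : contOneCocycles (discreteTopRep G (localPoints W (v.adicCompletion K))))
    (hφ : ∀ g, φ.1 g ∈ W.localKernelOfReduction v) :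
    ∃ a ∈ W.localKernelOfReduction v, ∀ g : G, φ.1 g = g • a - a := by
  have hw := coe_spectralValuation v
  -- the `K_v`-rational change to the minimal model and the spectral model
  set C₀ : VariableChange (v.adicCompletion K) :=
    ((W.baseChange (v.adicCompletion K)).exists_isMinimal (v.adicCompletionIntegers K)).choose with hC₀
  have hW₀ : C₀.map (algebraMap (v.adicCompletion K) (AlgebraicClosure (v.adicCompletion K))) •
      (W.baseChange (v.adicCompletion K)).baseChange (AlgebraicClosure (v.adicCompletion K)) =
      (W.localSpectralModel v).baseChange (AlgebraicClosure (v.adicCompletion K)) := by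
    rw [← VariableChange.baseChange_smul_eq, hC₀, W.smul_baseChange_eq_map_localMinimalIntegralModel v,
      W.localSpectralModel_baseChange v]
  have hΔ : IsUnit (W.localSpectralModel v).Δ := W.isUnit_Δ_localSpectralModel hgood
  have hGC : ∀ σ ∈ G, (C₀.map (algebraMap (v.adicCompletion K)
      (AlgebraicClosure (v.adicCompletion K)))).map ((absoluteGaloisGroup.toAlgEquiv (v.adicCompletion K) σ :
        AlgebraicClosure (v.adicCompletion K) ≃ₐ[v.adicCompletion K]
          AlgebraicClosure (v.adicCompletion K)) :
        AlgebraicClosure (v.adicCompletion K) →+* AlgebraicClosure (v.adicCompletion K)) =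
      C₀.map (algebraMap (v.adicCompletion K) (AlgebraicClosure (v.adicCompletion K))) := by
    intro σ _
    rw [VariableChange.map_map]
    congr 1
    ext x
    exact AlgEquiv.commutes _ x
  -- membership in `localKernelOfReduction v` is membership of the transport in `kernelOfReduction`
  have hmem : ∀ P : localPoints W (v.adicCompletion K), P ∈ W.localKernelOfReduction v ↔
      Affine.Point.congrEquiv hW₀ (VariableChange.pointEquiv _
        (C₀.map (algebraMap (v.adicCompletion K) (AlgebraicClosure (v.adicCompletion K))))
        (Affine.Point.congrEquiv (baseChange_baseChange_adicCompletion W v).symm P)) ∈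
        kernelOfReduction (W.localSpectralModel v) (Valuation.integer.integers v.spectralValuation) := by
    intro P
    rw [localKernelOfReduction, AddSubgroup.mem_comap]
    change W.localPointsEquivSpectralModel v P ∈ _ ↔ _
    rw [localPointsEquivSpectralModel, AddEquiv.trans_apply, localPointsEquivModel_apply,
      localPointsEquivPoint_apply, VariableChange.pointEquivBaseChange, AddEquiv.trans_apply]
    erw [Affine.Point.congrEquiv_congrEquiv', Affine.Point.congrEquiv_congrEquiv']
  obtain ⟨a, ha, hφa⟩ := hG v.spectralValuation hw _ (W.localSpectralModel v) hW₀ hΔ hGC φ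
    (fun g ↦ (hmem _).1 (hφ g))
  exact ⟨a, (hmem a).2 ha, hφa⟩

end WeierstrassCurve

end
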